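import Literature.IUT.HodgeTheaters.TemperedCoveringsOfSpecialFibreFiniteGraph
import Literature.IUT.HodgeTheaters.StableCurveTemperedDataOfSpecialFibreWholeGraph
import Literature.IUT.HodgeTheaters.StableCurveTemperedDataOfSpecialFibreCuspedPiDataNVExposed
import Literature.IUT.HodgeTheaters.StableCurveTemperedDataOfSpecialFibreProp24Compact
import Literature.IUT.HodgeTheaters.ProfiniteCompletionRestrictOpen
import HarnessLib

/-!
# The finite-special-fibre closers of [IUTchI] Prop. 2.1 / Prop. 2.2 / Rmk. 2.2.2 AT `ofSpecialFibre` are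
# JOINTLY NON-VACUOUS: their residual binders are inhabited at one 𝔛-datum and the closers FIRE there

S. Mochizuki, *Inter-universal Teichmüller theory I*, kurims manuscript (May 2020), §2, Prop. 2.1 p. 45, Prop. 2.2
pp. 45–46, Rmk. 2.2.2 p. 46 [cite: Mochizuki2012, Prop 2.1 p.45; Prop 2.2 pp.45-46] (D-0012 claim key; series status
DISPUTED; nothing of the series is asserted here); S. Mochizuki, *Semi-graphs of anabelioids*, Publ. RIMS **42**
(2006), Ex. 3.10 p. 44, Thm. 3.7 pp. 40–41 [cite: MochizukiSemiAnbd2006, Ex 3.10 p.44]; Y. Hoshi, S. Mochizuki,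
[NodNon] Lem. 1.9 (ii) p. 291.

PROOF-ONLY non-vacuity file (abc-iut cell, L5 [IUTchI] §2 lineage, seat abc-iut-L5-t11; no definition, no instance,
no notation, no new `Prop` fact; nothing restated, no statement file edited).  abc-iut-f-192's closers
(`TemperedCoveringsOfSpecialFibreFiniteGraph.lean`, p433285) prove, at the genuine §2 𝔛-datum `𝔇 := StableCurveTemperedData.ofSpecialFibre X d S h36 Σ Σ̂ … ℍ …` with FINITE
special-fibre semi-graph, the typed predicates `𝔇.graph.ProfiniteConjugatesOfCompactSubgroups` (Prop. 2.1, F-2589),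
`IsCommensurablyTerminal 𝔇.graph.ι.range` / `𝔇.graph.CommensuratorsOfDecompositionSubgroups` (Prop. 2.2, F-2590) and
`𝔇.graph.TemperedNormallyTerminal` (Rmk. 2.2.2, F-2591) modulo RESIDUAL BINDERS ONLY: a verticial family `Λv/hΛv` of
the special-fibre chart, node data `E src tgt c₁ c₂` with the adjacency alternative (A3) `hA3` — in the BY-NAME forms
a `PSCDatum` on `Π̂_𝔾` with [NodNon] Lem. 1.9 (ii) `VerticialIntersectionNear` (FACT-LIST F-2540) — and, for Prop. 2.2
AS TYPED over a sub-semi-graph `ℍ`, the `ℍ`-side chart data `cH eH h𝒢H hPCH GH …` and `hHatH`.  This file shows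
that ALL these binders are JOINTLY INHABITED at one datum and that each closer ELABORATES (is CALLED) there:

* `…_of_oneVertex` (any parameters `Σ Σ̂ ℍ …`): at ANY 𝔛-datum with COMPACT `Π^temp_{X_K}`, at most one vertex of
  `G^c`, finitely many edges and `⊤ ≤ π₁^temp(G^c)` verticial, every closer FIRES with `Λv := ⊤`, EMPTY node data
  and (A3) by its first disjunct (`ι(⊤) = ⊤` because the completion map of a compact group is onto — abc-iut-f-193's
  `graph_ι_surjective_of_compactSpace`); the BY-NAME forms fire over the one-vertex `PSCDatum` (`Π_v := ⊤`, no node,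
  no cusp) whose `VerticialIntersectionNear` holds by its first disjunct; the `ℍ`-side of Prop. 2.2 AS TYPED fires
  at `ℍ := 𝔾` (`Π^tp_ℍ := ⊤`, `Π̂_ℍ := ⊤`) with `cH := S.chart`, `eH : ⊤ ≃ₜ* π₁^temp(G^c)`, `h𝒢H := S.hyp`, `hPCH` from
  abc-iut-L5-t11's `isProfiniteCompletion_restrict`, and `hHatH : C_{Π̂_𝔾}(Π̂_𝔾) = Π̂_𝔾`;
* `…_nonvacuous` (binder-free HEADLINES): for every prime `p` such a datum EXISTS — abc-iut-f-193 / abc-iut-L3-t3's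
  cusped free-profinite witness with EXPOSED base fibre (`exists_temperedCurve_freeProfiniteTwo_cusped_exposed`:
  `Π^temp := G_{ℚ_p} × F̂₂` compact, `G^c` one vertex, no edge, `⊤` the (only) verticial subgroup) — so that
  `∃ X d S, … ∧ ∀ h36 Σ Σ̂ … ℍ …, 𝔇.graph.ProfiniteConjugatesOfCompactSubgroups ∧ …` and
  `∃ X d S, … ∧ ∀ h36 Σ Σ̂ …, (𝔇 at ℍ := 𝔾).graph.CommensuratorsOfDecompositionSubgroups` hold BY CALLING the closers.

GLOBAL TAG: «[degenerate; one-vertex base fibre; ⊤ verticial; COMPACT Π^temp (the model's tempered group is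
profinite, so `Π^tp_𝔾 = Π̂_𝔾`); `ℍ := 𝔾` (a one-vertex semi-graph has no proper nonempty sub-semi-graph)]» —
inhabited ≠ discharged.  HONEST TAGS PER BINDER: `Λv := ⊤`/`hΛv` — the (E2) structure of the witness (GENUINE-SHAPE
for this model); node data — VACUOUS (empty node type); (A3) / `VerticialIntersectionNear` — DEGENERATE (first
disjunct, `ι(⊤) = ⊤`); `ℍ`-side chart data — `𝔾`'s own chart re-used at `ℍ := 𝔾`; `hPCH` — a theorem
(restriction of a profinite completion to the open finite-index subgroup `⊤`); `hHatH` — DEGENERATE (`C(⊤) = ⊤`).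
The CONCLUSIONS at such a datum are content-free and already in the tree (abc-iut-f-193's
`graph_prop21_ofSpecialFibre_of_compactSpace`, p440842); what is new is the NON-VACUITY OF THE CLOSERS' HYPOTHESIS
SETS at `(ofSpecialFibre …).graph` itself (the §2 NV of record, `sec2_oneCall_frame_nonvacuous`, inhabits the
same-named binders at the tower LEVELS).  abc-iut-L3-t2's HONEST LIMITS carried: consistency evidence for OUR binders
only — not the special fibre of a curve, not André's `π₁^temp`.  Nothing here bears on [IUTchIII] Cor. 3.12;
typed ≠ inhabited ≠ discharged; nothing here asserts that abc is proved or refuted.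
-/

noncomputable section

namespace Literature.IUT.HodgeTheaters

open _root_.Topology
open scoped Pointwise
open Literature.AnabelianGeometry.SemiGraphs Literature.AnabelianGeometry.SemiGraphs.ProfiniteSemiGraph
open Literature.AnabelianGeometry.AbsoluteAnabelian (IsCommensurablyTerminal)

/-! ### A. Group-theoretic bookkeeping -/

/-- `C_G(G) = G`: the full subgroup is commensurably terminal. [cite: MochizukiAbsAnab2004, Def 0.1 (iii) p.4] -/
private theorem isCommensurablyTerminal_top_nv {G : Type*} [Group G] :
    IsCommensurablyTerminal (⊤ : Subgroup G) := by
  refine ⟨eq_top_iff.mpr fun g _ => ?_⟩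
  rw [Subgroup.Commensurable.commensurator_mem_iff]
  have : ConjAct.toConjAct g • (⊤ : Subgroup G) = ⊤ :=
    eq_top_iff.mpr fun x _ => by
      rw [Subgroup.mem_pointwise_smul_iff_inv_smul_mem]
      exact Subgroup.mem_top _
  rw [this]

/-- `H ≃ₜ* G` for a subgroup `H = ⊤` (the identity chart of `ℍ := 𝔾`), as an existence statement.
[cite: MochizukiSemiAnbd2006, §3 p.38] -/
private theorem exists_continuousMulEquiv_of_eq_top {G : Type*} [Group G] [TopologicalSpace G]
    (H : Subgroup G) (hH : H = ⊤) : ∃ e : H ≃ₜ* G, ∀ x, e x = (x : G) := by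
  subst hH
  exact
    ⟨{ toFun := fun x => (x : G)
       invFun := fun g => ⟨g, Subgroup.mem_top g⟩
       left_inv := fun _ => rfl
       right_inv := fun _ => rfl
       map_mul' := fun _ _ => rfl
       continuous_toFun := continuous_subtype_val
       continuous_invFun := continuous_id.subtype_mk _ }, fun _ => rfl⟩

/-- **The one-vertex `PSCDatum` with `Π_v := ⊤`** on ANY topological group (no node, no cusp, `Σ :=` all primes):
[NodNon] Lem. 1.9 (ii)'s shape `VerticialIntersectionNear` (FACT-LIST F-2540) holds by its FIRST disjunct.
DEGENERATE bookkeeping; nothing of [NodNon] is proved. [cite: HoshiMochizukiNodNon2011, Lem 1.9 (ii) p.291] -/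
private theorem exists_oneVertexPSCDatum (P : Type*) [Group P] [TopologicalSpace P] :
    ∃ G : PSCDatum P, G.VerticialIntersectionNear ∧ IsEmpty G.graph.N ∧ Nonempty (Unique G.graph.V) ∧
      ∀ v, G.vertGp v = ⊤ := by
  refine ⟨{ Sigma := {q | q.Prime}
            sigma_prime := fun _ hq => hq
            sigma_nonempty := ⟨2, Nat.prime_two⟩
            graph := { V := PUnit, N := PEmpty, C := PEmpty, nodeEnds := fun e => e.elim,
                       cuspEnd := fun c => c.elim }
            vertGp := fun _ => ⊤
            nodeGp := fun e => e.elim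
            cuspGp := fun c => c.elim
            genus := fun _ => 0
            isClosed_vertGp := fun _ => by rw [Subgroup.coe_top]; exact isClosed_univ
            isClosed_nodeGp := fun e => e.elim
            isClosed_cuspGp := fun c => c.elim
            nodeGp_le := fun e => e.elim
            cuspGp_le := fun c => c.elim
            proSigma := ⟨fun _ _ _ hq _ => hq⟩ }, ?_, ?_, ?_, fun _ => rfl⟩
  · intro ε v w g h _
    exact Or.inl ⟨Subsingleton.elim _ _, Subgroup.mem_top _⟩
  · exact (inferInstance : IsEmpty PEmpty)
  · exact ⟨(inferInstance : Unique PUnit)⟩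

namespace StableCurveTemperedData

namespace OfSpecialFibre

variable {p : ℕ} [Fact p.Prime] (X : TemperedCurve p) (d : X.GroupLevelData)
  (S : SpecialFibreData (X.toTemperedArithmeticGroup d)) (h36 : S.Gc.Prop36Hypotheses)
  (Sigma SigmaHat : Set ℕ) (hsub : Sigma ⊆ SigmaHat) (hne : Sigma.Nonempty)
  (hprime : ∀ q ∈ SigmaHat, q.Prime) (hp : p ∉ Sigma)
  (TpH : Subgroup S.chart.G)
  (HatH : Subgroup (TemperedGraphGroupData.exists_completion_of_prop36 S.Gc h36 S.chart).choose)
  (hle : TpH.map (TemperedGraphGroupData.exists_completion_of_prop36 S.Gc h36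
    S.chart).choose_spec.choose.toMonoidHom ≤ HatH)
  (cuspMeetsH : {x : X.Pt // X.IsCusp x} → Prop)

/-! ### B. `ι(⊤) = ⊤` at the special fibre for compact `Π^temp_{X_K}` -/

/-- At compact `Π^temp_{X_K}` the graph level `Π^tp_𝔾 ↪ Π̂_𝔾` of the genuine datum is onto (abc-iut-f-193's
`graph_ι_surjective_of_compactSpace`): `ι(⊤) = ⊤`. [cite: MochizukiSemiAnbd2006, Ex 3.10 p.44] -/
theorem graph_map_top_eq_top_of_compactSpace [CompactSpace X.PiTemp] :
    (⊤ : Subgroup (ofSpecialFibre X d S h36 Sigma SigmaHat hsub hne hprime hp TpH HatH hle cuspMeetsH).graph.Tp).map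
      (ofSpecialFibre X d S h36 Sigma SigmaHat hsub hne hprime hp TpH HatH hle cuspMeetsH).graph.ι = ⊤ := by
  refine eq_top_iff.mpr fun y _ => ?_
  obtain ⟨t, rfl⟩ :=
    graph_ι_surjective_of_compactSpace X d S h36 Sigma SigmaHat hsub hne hprime hp TpH HatH hle cuspMeetsH y
  exact ⟨t, Subgroup.mem_top _, rfl⟩

/-! ### C. The closers FIRE at any datum with compact `Π^temp_{X_K}`, ≤ 1 vertex, `⊤` verticial -/

/-- **F-2589 closer FIRES** — [IUTchI] Prop. 2.1 AS TYPED at the genuine 𝔛-datum, obtained by CALLING abc-iut-f-192's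
`graph_prop21_ofSpecialFibre_of_finiteGraph` with `Λv := ⊤`, EMPTY node data, (A3) by its first disjunct, at any datum
with compact `Π^temp_{X_K}`, at most one vertex, finitely many edges and `⊤` verticial (any `Σ Σ̂ ℍ …`).  DEGENERATE.
([IUTchI] Prop 2.1 p.45) [claim: Mochizuki2012, status: disputed] -/
theorem graph_prop21_ofSpecialFibre_of_finiteGraph_of_oneVertex [CompactSpace X.PiTemp]
    [Subsingleton S.Gc.graph.Vertex] [Finite S.Gc.graph.Edge]
    (htop : ∀ v, (⊤ : Subgroup S.chart.G) ∈ verticialSubgroups S.chart v) :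
    (ofSpecialFibre X d S h36 Sigma SigmaHat hsub hne hprime hp TpH HatH hle
      cuspMeetsH).graph.ProfiniteConjugatesOfCompactSubgroups := by
  have hmap := graph_map_top_eq_top_of_compactSpace X d S h36 Sigma SigmaHat hsub hne hprime hp TpH HatH hle
    cuspMeetsH
  exact graph_prop21_ofSpecialFibre_of_finiteGraph X d S h36 Sigma SigmaHat hsub hne hprime hp TpH HatH hle
    cuspMeetsH (fun _ => ⊤) htop (fun e : Empty => e.elim) (fun e : Empty => e.elim)
    (fun e : Empty => e.elim) (fun e : Empty => e.elim)
    (fun v w g h _ => Or.inl ⟨Subsingleton.elim _ _, by rw [hmap]; exact Subgroup.mem_top _⟩)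

/-- **F-2590 clause `tp_in_hat` closer FIRES** — "`Π^tp_𝔾` is commensurably terminal in `Π̂_𝔾`" at the genuine
𝔛-datum by CALLING `graph_tp_isCommensurablyTerminal_ofSpecialFibre_of_finiteGraph` (`Λv := ⊤`, empty node data,
(A3) first disjunct).  DEGENERATE. ([IUTchI] Prop 2.2 p.45) [claim: Mochizuki2012, status: disputed] -/
theorem graph_tp_isCommensurablyTerminal_ofSpecialFibre_of_finiteGraph_of_oneVertex [CompactSpace X.PiTemp]
    [Subsingleton S.Gc.graph.Vertex] [Finite S.Gc.graph.Edge]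
    (htop : ∀ v, (⊤ : Subgroup S.chart.G) ∈ verticialSubgroups S.chart v) :
    IsCommensurablyTerminal
      (ofSpecialFibre X d S h36 Sigma SigmaHat hsub hne hprime hp TpH HatH hle cuspMeetsH).graph.ι.range := by
  have hmap := graph_map_top_eq_top_of_compactSpace X d S h36 Sigma SigmaHat hsub hne hprime hp TpH HatH hle
    cuspMeetsH
  exact graph_tp_isCommensurablyTerminal_ofSpecialFibre_of_finiteGraph X d S h36 Sigma SigmaHat hsub hne hprime hp
    TpH HatH hle cuspMeetsH (fun _ => ⊤) htop (fun e : Empty => e.elim) (fun e : Empty => e.elim)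
    (fun e : Empty => e.elim) (fun e : Empty => e.elim)
    (fun v w g h _ => Or.inl ⟨Subsingleton.elim _ _, by rw [hmap]; exact Subgroup.mem_top _⟩)

/-- **F-2591 closer FIRES** — [IUTchI] Rmk. 2.2.2 (`Π^tp_𝔾` normally terminal in `Π̂_𝔾`) at the genuine 𝔛-datum by
CALLING `graph_temperedNormallyTerminal_ofSpecialFibre_of_finiteGraph` (`Λv := ⊤`, empty node data, (A3) first
disjunct).  DEGENERATE. ([IUTchI] Rmk 2.2.2 p.46) [claim: Mochizuki2012, status: disputed] -/
theorem graph_temperedNormallyTerminal_ofSpecialFibre_of_finiteGraph_of_oneVertex [CompactSpace X.PiTemp]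
    [Subsingleton S.Gc.graph.Vertex] [Finite S.Gc.graph.Edge]
    (htop : ∀ v, (⊤ : Subgroup S.chart.G) ∈ verticialSubgroups S.chart v) :
    (ofSpecialFibre X d S h36 Sigma SigmaHat hsub hne hprime hp TpH HatH hle
      cuspMeetsH).graph.TemperedNormallyTerminal := by
  have hmap := graph_map_top_eq_top_of_compactSpace X d S h36 Sigma SigmaHat hsub hne hprime hp TpH HatH hle
    cuspMeetsH
  exact graph_temperedNormallyTerminal_ofSpecialFibre_of_finiteGraph X d S h36 Sigma SigmaHat hsub hne hprime hp
    TpH HatH hle cuspMeetsH (fun _ => ⊤) htop (fun e : Empty => e.elim) (fun e : Empty => e.elim)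
    (fun e : Empty => e.elim) (fun e : Empty => e.elim)
    (fun v w g h _ => Or.inl ⟨Subsingleton.elim _ _, by rw [hmap]; exact Subgroup.mem_top _⟩)

/-! ### D. The BY-NAME closers FIRE over the one-vertex `PSCDatum` on `Π̂_𝔾` (F-2540 by its first disjunct) -/

/-- **F-2589 BY-NAME closer FIRES** — [IUTchI] Prop. 2.1 AS TYPED at the genuine 𝔛-datum by CALLING
`graph_prop21_byName_ofSpecialFibre_of_finiteGraph` over the one-vertex `PSCDatum` on `Π̂_𝔾` (`Π_v := ⊤ = ι(⊤)`, no node,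
no cusp; `VerticialIntersectionNear` by its first disjunct), `σ` from `Unique`, `Λv := ⊤`, empty node data — at any
datum with compact `Π^temp_{X_K}`, exactly one vertex, finitely many edges and `⊤` verticial; together with the
BY-NAME "in particular" clause of Prop. 2.2 and Rmk. 2.2.2 (`graph_prop22_inParticular_byName_…`,
`graph_temperedNormallyTerminal_byName_…`) at the same data.  DEGENERATE.
([IUTchI] Prop 2.1 p.45, Prop 2.2 p.45, Rmk 2.2.2 p.46) [claim: Mochizuki2012, status: disputed] -/
theorem graph_prop21_prop22_byName_ofSpecialFibre_of_finiteGraph_of_oneVertex [CompactSpace X.PiTemp]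
    [Unique S.Gc.graph.Vertex] [Finite S.Gc.graph.Edge]
    (htop : ∀ v, (⊤ : Subgroup S.chart.G) ∈ verticialSubgroups S.chart v) :
    (ofSpecialFibre X d S h36 Sigma SigmaHat hsub hne hprime hp TpH HatH hle
        cuspMeetsH).graph.ProfiniteConjugatesOfCompactSubgroups ∧
      IsCommensurablyTerminal
        (ofSpecialFibre X d S h36 Sigma SigmaHat hsub hne hprime hp TpH HatH hle cuspMeetsH).graph.ι.range ∧
      (ofSpecialFibre X d S h36 Sigma SigmaHat hsub hne hprime hp TpH HatH hle
        cuspMeetsH).graph.TemperedNormallyTerminal := by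
  have hmap := graph_map_top_eq_top_of_compactSpace X d S h36 Sigma SigmaHat hsub hne hprime hp TpH HatH hle
    cuspMeetsH
  obtain ⟨G, hNN, hN, ⟨hU⟩, hvG⟩ := exists_oneVertexPSCDatum
    (ofSpecialFibre X d S h36 Sigma SigmaHat hsub hne hprime hp TpH HatH hle cuspMeetsH).graph.Hat
  haveI := hN
  haveI := hU
  have hΛv : ∀ v, (⊤ : Subgroup (ofSpecialFibre X d S h36 Sigma SigmaHat hsub hne hprime hp TpH HatH hle
      cuspMeetsH).graph.Tp).map
        (ofSpecialFibre X d S h36 Sigma SigmaHat hsub hne hprime hp TpH HatH hle cuspMeetsH).graph.ι =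
      G.vertGp v := fun v => by rw [hvG v]; exact hmap
  refine ⟨?_, ?_, ?_⟩
  · exact graph_prop21_byName_ofSpecialFibre_of_finiteGraph X d S h36 Sigma SigmaHat hsub hne hprime hp TpH HatH
      hle cuspMeetsH G hNN (Equiv.ofUnique _ _) (fun _ => ⊤) htop hΛv (fun e => isEmptyElim e)
      (fun e => isEmptyElim e) (fun e => isEmptyElim e) (fun e => isEmptyElim e) (fun e => isEmptyElim e)
      (fun e => isEmptyElim e) (fun e => isEmptyElim e) (fun e => isEmptyElim e)
  · exact graph_prop22_inParticular_byName_ofSpecialFibre_of_finiteGraph X d S h36 Sigma SigmaHat hsub hne hprime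
      hp TpH HatH hle cuspMeetsH G hNN (Equiv.ofUnique _ _) (fun _ => ⊤) htop hΛv (fun e => isEmptyElim e)
      (fun e => isEmptyElim e) (fun e => isEmptyElim e) (fun e => isEmptyElim e) (fun e => isEmptyElim e)
      (fun e => isEmptyElim e) (fun e => isEmptyElim e) (fun e => isEmptyElim e)
  · exact graph_temperedNormallyTerminal_byName_ofSpecialFibre_of_finiteGraph X d S h36 Sigma SigmaHat hsub hne
      hprime hp TpH HatH hle cuspMeetsH G hNN (Equiv.ofUnique _ _) (fun _ => ⊤) htop hΛv (fun e => isEmptyElim e)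
      (fun e => isEmptyElim e) (fun e => isEmptyElim e) (fun e => isEmptyElim e) (fun e => isEmptyElim e)
      (fun e => isEmptyElim e) (fun e => isEmptyElim e) (fun e => isEmptyElim e)

/-! ### E. Prop. 2.2 AS TYPED over a sub-semi-graph `ℍ`, EVERY input BY NAME, FIRES at `ℍ := 𝔾` -/

/-- **F-2590 closer AS TYPED with the `ℍ`-side data BY NAME FIRES** — [IUTchI] Prop. 2.2 (all four clauses) at the
genuine 𝔛-datum by CALLING abc-iut-f-192's `graph_prop22_byName_ofSpecialFibre_of_finiteGraph` with EVERY binder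
inhabited, at `ℍ := 𝔾` (`Π^tp_ℍ := ⊤`, `Π̂_ℍ := ⊤`; a one-vertex semi-graph has no proper nonempty sub-semi-graph):
the `𝔾`-side over the one-vertex `PSCDatum` on `Π̂_𝔾` as in part D; the `ℍ`-side with `𝒢H := G^c`, `cH := S.chart`,
`eH : ⊤ ≃ₜ* π₁^temp(G^c)`, `h𝒢H := S.hyp`, `hPCH` := abc-iut-L5-t11's `isProfiniteCompletion_restrict` (restriction of
the completion `Π^tp_𝔾 → Π̂_𝔾` to the open finite-index subgroup `⊤`, whose image closure is `⊤ = ι(⊤)`), the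
one-vertex `PSCDatum` on `Π̂_ℍ = ⊤`, `ΛvH := ⊤`, empty node data, and `hHatH : C_{Π̂_𝔾}(⊤) = ⊤` — at any datum with
compact `Π^temp_{X_K}`, exactly one vertex, finitely many edges and `⊤` verticial (any `Σ Σ̂`, any (vi)(b) atom).
DEGENERATE. ([IUTchI] Prop 2.2 pp.45-46) [claim: Mochizuki2012, status: disputed] -/
theorem graph_prop22_byName_ofSpecialFibre_of_finiteGraph_of_oneVertex [CompactSpace X.PiTemp]
    [Unique S.Gc.graph.Vertex] [Finite S.Gc.graph.Edge]
    (htop : ∀ v, (⊤ : Subgroup S.chart.G) ∈ verticialSubgroups S.chart v) :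
    (ofSpecialFibre X d S h36 Sigma SigmaHat hsub hne hprime hp ⊤ ⊤ (wholeGraph_hle X d S h36)
      cuspMeetsH).graph.CommensuratorsOfDecompositionSubgroups := by
  set D := ofSpecialFibre X d S h36 Sigma SigmaHat hsub hne hprime hp ⊤ ⊤ (wholeGraph_hle X d S h36) cuspMeetsH
  haveI := ofSpecialFibre_graph_t2Space X d S h36 Sigma SigmaHat hsub hne hprime hp ⊤ ⊤ (wholeGraph_hle X d S h36)
    cuspMeetsH
  have hsurj := graph_ι_surjective_of_compactSpace X d S h36 Sigma SigmaHat hsub hne hprime hp ⊤ ⊤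
    (wholeGraph_hle X d S h36) cuspMeetsH
  have hmap := graph_map_top_eq_top_of_compactSpace X d S h36 Sigma SigmaHat hsub hne hprime hp ⊤ ⊤
    (wholeGraph_hle X d S h36) cuspMeetsH
  have hPC := ofSpecialFibre_graph_isProfiniteCompletion X d S h36 Sigma SigmaHat hsub hne hprime hp ⊤ ⊤
    (wholeGraph_hle X d S h36) cuspMeetsH
  -- the `𝔾`-side identification data over the one-vertex `PSCDatum` on `Π̂_𝔾`
  obtain ⟨G, hNN, hN, ⟨hU⟩, hvG⟩ := exists_oneVertexPSCDatum D.graph.Hat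
  haveI := hN
  haveI := hU
  have hΛv : ∀ v, (⊤ : Subgroup D.graph.Tp).map D.graph.ι = G.vertGp v := fun v => by rw [hvG v]; exact hmap
  -- the `ℍ`-side at `ℍ := 𝔾`: `Π̂_ℍ = ⊤` is closed
  have hcH : IsClosed (D.graph.HatH : Set D.graph.Hat) := by
    rw [show D.graph.HatH = ⊤ from rfl, Subgroup.coe_top]
    exact isClosed_univ
  -- the chart of `ℍ := 𝔾`: `Π^tp_ℍ = ⊤ ≃ₜ* π₁^temp(G^c)`
  obtain ⟨eH, heH⟩ := exists_continuousMulEquiv_of_eq_top D.graph.TpH rfl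
  -- `ι_ℍ : Π^tp_ℍ → Π̂_ℍ` is onto, `ι_ℍ(⊤) = ⊤`
  have hsurjH : Function.Surjective (D.graph.restrictH hcH).ι := fun y => by
    obtain ⟨t, ht⟩ := hsurj (y : D.graph.Hat)
    exact ⟨⟨t, Subgroup.mem_top t⟩, Subtype.ext ht⟩
  have hmapH : (⊤ : Subgroup (D.graph.restrictH hcH).Tp).map (D.graph.restrictH hcH).ι = ⊤ := by
    refine eq_top_iff.mpr fun y _ => ?_
    obtain ⟨t, rfl⟩ := hsurjH y
    exact ⟨t, Subgroup.mem_top _, rfl⟩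
  -- `hPCH`: the restricted completion map is a profinite completion (open finite-index subgroup `⊤`)
  haveI hFI : (D.graph.TpH).FiniteIndex := by
    rw [show D.graph.TpH = ⊤ from rfl]
    infer_instance
  have hUo : IsOpen (D.graph.TpH : Set D.graph.Tp) := by
    rw [show D.graph.TpH = ⊤ from rfl, Subgroup.coe_top]
    exact isOpen_univ
  have hW : D.graph.HatH = ((D.graph.TpH).map D.graph.ι).topologicalClosure := by
    rw [show D.graph.HatH = ⊤ from rfl, show D.graph.TpH = ⊤ from rfl, hmap]
    exact (top_le_iff.mp (Subgroup.le_topologicalClosure _)).symm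
  have hPCH := ProfiniteCompletionRestrict.isProfiniteCompletion_restrict hPC _ hUo _ hW
    ({ toMonoidHom := (D.graph.restrictH hcH).ι, continuous_toFun := (D.graph.restrictH hcH).ι_continuous })
    (fun _ => rfl)
  -- the one-vertex `PSCDatum` on `Π̂_ℍ`
  obtain ⟨GH, hNNH, hNH, ⟨hUH⟩, hvGH⟩ := exists_oneVertexPSCDatum (D.graph.restrictH hcH).Hat
  haveI := hNH
  haveI := hUH
  have hΛvH : ∀ v, (⊤ : Subgroup (D.graph.restrictH hcH).Tp).map (D.graph.restrictH hcH).ι = GH.vertGp v :=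
    fun v => by rw [hvGH v]; exact hmapH
  -- `hHatH : C_{Π̂_𝔾}(Π̂_ℍ) = Π̂_ℍ` at `Π̂_ℍ = ⊤`
  have hHatH : IsCommensurablyTerminal D.graph.HatH := by
    rw [show D.graph.HatH = ⊤ from rfl]
    exact isCommensurablyTerminal_top_nv
  -- THE CALL
  exact graph_prop22_byName_ofSpecialFibre_of_finiteGraph X d S h36 Sigma SigmaHat hsub hne hprime hp ⊤ ⊤
    (wholeGraph_hle X d S h36) cuspMeetsH G hNN (Equiv.ofUnique _ _) (fun _ => ⊤) htop hΛv
    (fun e => isEmptyElim e) (fun e => isEmptyElim e) (fun e => isEmptyElim e) (fun e => isEmptyElim e)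
    (fun e => isEmptyElim e) (fun e => isEmptyElim e) (fun e => isEmptyElim e) (fun e => isEmptyElim e)
    hcH S.chart eH S.hyp hPCH GH hNNH (Equiv.ofUnique _ _) (fun _ => ⊤)
    (fun v => by
      -- `ΛvH := ⊤` is carried by `eH` onto the verticial subgroup `⊤` of the chart
      convert htop v using 2
      refine eq_top_iff.mpr fun y _ => ?_
      exact ⟨⟨y, Subgroup.mem_top y⟩, Subgroup.mem_top _, heH _⟩)
    hΛvH
    (fun e => isEmptyElim e) (fun e => isEmptyElim e) (fun e => isEmptyElim e) (fun e => isEmptyElim e)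
    (fun e => isEmptyElim e) (fun e => isEmptyElim e) (fun e => isEmptyElim e) (fun e => isEmptyElim e) hHatH

/-! ### F. Binder-free HEADLINES: such a datum EXISTS for every `p` (the cusped free-profinite witness) -/

/-- **[IUTchI] Prop. 2.1 / Prop. 2.2 "in particular" / Rmk. 2.2.2 closers AT `ofSpecialFibre`: JOINTLY NON-VACUOUS
(binder-free headline).**  For every prime `p` there EXIST a `TemperedCurve p` datum `X`, a parameter bundle `d` and
special-fibre data `S` with FINITE (one-vertex, edgeless) special-fibre semi-graph, `⊤ ≤ π₁^temp(G^c)` verticial and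
compact `Π^temp_{X_K}` — abc-iut-f-193 / abc-iut-L3-t3's cusped free-profinite witness with exposed base fibre — such
that FOR EVERY `h36 Σ Σ̂ ℍ …` (i) the residual (A3) binder of abc-iut-f-192's closers HOLDS at `Λv := ⊤` with empty
node data (first disjunct), and (ii) the conclusions `𝔇.graph.ProfiniteConjugatesOfCompactSubgroups` (F-2589),
`IsCommensurablyTerminal 𝔇.graph.ι.range` (F-2590 `tp_in_hat`), `𝔇.graph.TemperedNormallyTerminal` (F-2591) HOLD,
obtained by CALLING the closers (parts C, D).  DEGENERATE WITNESS (module docstring).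
([IUTchI] Prop 2.1 p.45, Prop 2.2 p.45, Rmk 2.2.2 p.46) [claim: Mochizuki2012, status: disputed] -/
theorem graph_prop21_ofSpecialFibre_of_finiteGraph_nonvacuous (p : ℕ) [Fact p.Prime] :
    ∃ (X : TemperedCurve p) (d : X.GroupLevelData) (S : SpecialFibreData (X.toTemperedArithmeticGroup d)),
      Nonempty (Unique S.Gc.graph.Vertex) ∧ IsEmpty S.Gc.graph.Edge ∧
      (∀ v, (⊤ : Subgroup S.chart.G) ∈ verticialSubgroups S.chart v) ∧ CompactSpace X.PiTemp ∧
      ∀ (h36 : S.Gc.Prop36Hypotheses) (Sigma SigmaHat : Set ℕ) (hsub : Sigma ⊆ SigmaHat) (hne : Sigma.Nonempty)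
        (hprime : ∀ q ∈ SigmaHat, q.Prime) (hp : p ∉ Sigma) (TpH : Subgroup S.chart.G)
        (HatH : Subgroup (TemperedGraphGroupData.exists_completion_of_prop36 S.Gc h36 S.chart).choose)
        (hle : TpH.map (TemperedGraphGroupData.exists_completion_of_prop36 S.Gc h36
          S.chart).choose_spec.choose.toMonoidHom ≤ HatH)
        (cuspMeetsH : {x : X.Pt // X.IsCusp x} → Prop),
        (∀ (v w : S.Gc.graph.Vertex)
            (g h : (ofSpecialFibre X d S h36 Sigma SigmaHat hsub hne hprime hp TpH HatH hle cuspMeetsH).graph.Hat),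
            MulAut.conj g • (⊤ : Subgroup (ofSpecialFibre X d S h36 Sigma SigmaHat hsub hne hprime hp TpH HatH hle
                cuspMeetsH).graph.Tp).map (ofSpecialFibre X d S h36 Sigma SigmaHat hsub hne hprime hp TpH HatH hle
                  cuspMeetsH).graph.ι ⊓
              MulAut.conj h • (⊤ : Subgroup (ofSpecialFibre X d S h36 Sigma SigmaHat hsub hne hprime hp TpH HatH
                hle cuspMeetsH).graph.Tp).map (ofSpecialFibre X d S h36 Sigma SigmaHat hsub hne hprime hp TpH HatH
                  hle cuspMeetsH).graph.ι ≠ ⊥ →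
            v = w ∧ g⁻¹ * h ∈ (⊤ : Subgroup (ofSpecialFibre X d S h36 Sigma SigmaHat hsub hne hprime hp TpH HatH hle
              cuspMeetsH).graph.Tp).map (ofSpecialFibre X d S h36 Sigma SigmaHat hsub hne hprime hp TpH HatH hle
                cuspMeetsH).graph.ι) ∧
        (ofSpecialFibre X d S h36 Sigma SigmaHat hsub hne hprime hp TpH HatH hle
            cuspMeetsH).graph.ProfiniteConjugatesOfCompactSubgroups ∧
        IsCommensurablyTerminal
            (ofSpecialFibre X d S h36 Sigma SigmaHat hsub hne hprime hp TpH HatH hle cuspMeetsH).graph.ι.range ∧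
        (ofSpecialFibre X d S h36 Sigma SigmaHat hsub hne hprime hp TpH HatH hle
            cuspMeetsH).graph.TemperedNormallyTerminal := by
  obtain ⟨X, d, S, -, -, -, -, -, -, -, -, -, -, hcpt, ⟨-, -, -, hUV₀, hE₀, -⟩, ⟨-, htop₀, -, -⟩⟩ :=
    SpecialFibreTower.PiData.exists_temperedCurve_freeProfiniteTwo_cusped_exposed p
  obtain ⟨hU⟩ := hUV₀
  haveI := hU; haveI := hE₀; haveI := hcpt
  refine ⟨X, d, S, ⟨hU⟩, hE₀, htop₀, hcpt, ?_⟩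
  intro h36 Sigma SigmaHat hsub hne hprime hp TpH HatH hle cuspMeetsH
  have hmap := graph_map_top_eq_top_of_compactSpace X d S h36 Sigma SigmaHat hsub hne hprime hp TpH HatH hle
    cuspMeetsH
  obtain ⟨-, h22, h222⟩ := graph_prop21_prop22_byName_ofSpecialFibre_of_finiteGraph_of_oneVertex X d S h36
    Sigma SigmaHat hsub hne hprime hp TpH HatH hle cuspMeetsH htop₀
  exact ⟨fun v w g h _ => ⟨Subsingleton.elim _ _, by rw [hmap]; exact Subgroup.mem_top _⟩,
    graph_prop21_ofSpecialFibre_of_finiteGraph_of_oneVertex X d S h36 Sigma SigmaHat hsub hne hprime hp TpH HatH hle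
      cuspMeetsH htop₀, h22, h222⟩

/-- **[IUTchI] Prop. 2.2 AS TYPED closer AT `ofSpecialFibre` (all four commensurator clauses, the certificate binder
`h22`): JOINTLY NON-VACUOUS (binder-free headline).**  For every prime `p` there EXIST `X d S` as above such that FOR
EVERY `h36 Σ Σ̂` and every (vi)(b) atom the conclusion
`(ofSpecialFibre X d S h36 Σ Σ̂ … ⊤ ⊤ (wholeGraph_hle …) …).graph.CommensuratorsOfDecompositionSubgroups` HOLDS at
`ℍ := 𝔾`, obtained by CALLING abc-iut-f-192's `graph_prop22_byName_ofSpecialFibre_of_finiteGraph` with every `𝔾`- and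
`ℍ`-side binder inhabited (part E).  DEGENERATE WITNESS (module docstring).
([IUTchI] Prop 2.2 pp.45-46) [claim: Mochizuki2012, status: disputed] -/
theorem graph_prop22_ofSpecialFibre_of_finiteGraph_nonvacuous (p : ℕ) [Fact p.Prime] :
    ∃ (X : TemperedCurve p) (d : X.GroupLevelData) (S : SpecialFibreData (X.toTemperedArithmeticGroup d)),
      Nonempty (Unique S.Gc.graph.Vertex) ∧ IsEmpty S.Gc.graph.Edge ∧
      (∀ v, (⊤ : Subgroup S.chart.G) ∈ verticialSubgroups S.chart v) ∧ CompactSpace X.PiTemp ∧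
      ∀ (h36 : S.Gc.Prop36Hypotheses) (Sigma SigmaHat : Set ℕ) (hsub : Sigma ⊆ SigmaHat) (hne : Sigma.Nonempty)
        (hprime : ∀ q ∈ SigmaHat, q.Prime) (hp : p ∉ Sigma) (cuspMeetsH : {x : X.Pt // X.IsCusp x} → Prop),
        (ofSpecialFibre X d S h36 Sigma SigmaHat hsub hne hprime hp ⊤ ⊤ (wholeGraph_hle X d S h36)
          cuspMeetsH).graph.CommensuratorsOfDecompositionSubgroups := by
  obtain ⟨X, d, S, -, -, -, -, -, -, -, -, -, -, hcpt, ⟨-, -, -, hUV₀, hE₀, -⟩, ⟨-, htop₀, -, -⟩⟩ :=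
    SpecialFibreTower.PiData.exists_temperedCurve_freeProfiniteTwo_cusped_exposed p
  obtain ⟨hU⟩ := hUV₀
  haveI := hU; haveI := hE₀; haveI := hcpt
  refine ⟨X, d, S, ⟨hU⟩, hE₀, htop₀, hcpt, ?_⟩
  intro h36 Sigma SigmaHat hsub hne hprime hp cuspMeetsH
  exact graph_prop22_byName_ofSpecialFibre_of_finiteGraph_of_oneVertex X d S h36 Sigma SigmaHat hsub hne hprime hp
    cuspMeetsH htop₀

end OfSpecialFibre

end StableCurveTemperedData

end Literature.IUT.HodgeTheaters

end
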